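import Literature.Algebra.Polynomial.ShefferSequences
import Mathlib.RingTheory.Polynomial.Hermite.Basic
import Mathlib.Data.Nat.Factorial.DoubleFactorial
import Mathlib.Tactic
import HarnessLib

/-!
# The Hermite polynomials as an Appell sequence (Rota–Kahaner–Odlyzko §10; Robert, Ch. IV §6.1)

G.-C. Rota, D. Kahaner, A. Odlyzko, *Finite operator calculus* (1973), §10 "Hermite polynomials":

> Define the Hermite polynomials of variance `v` to be the Appell set … whose operator is the
> Weierstrass operator `W_v`. The ordinary Hermite polynomials correspond to variance one. Thus,
> (*) `H_n^{(v)} (x) = W_v^{−1} x^n`, `D H_n^{(v)} (x) = n H_{n−1}^{(v)} (x)`,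
> `H_n^{(v)} (x + y) = Σ_{k≥0} C(n,k) y^{n−k} H_k^{(v)} (x)`, etc., trivially from Section 5.
> The indicator of the operator `W_v` is … `W_v = Σ a_n^{(v)} D^n/n!` with
> `a_n^{(v)} = v^{n/2} · 1 · 3 · 5 ⋯ (n − 1)` for `n` even, `0` for `n` odd.

The variance-one (probabilists') Hermite polynomials are Mathlib's `Polynomial.hermite n : ℤ[X]`
(`He_{n+1} = x He_n − He_n'`). We prove the derivative rule `He_{n+1}' = (n+1) He_n` (not in
Mathlib), hence that `(He_n)` is an **Appell sequence** in the sense of Robert §6.1 /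
`ShefferSequences`, the addition formula, and (*) in the form `He_n = e^{−D²/2} x^n`, where the
series `e^{−t²/2} = W_1^{−1}` is given coefficientwise (`expNegHalfSq`) and certified by
`E' = −t E`, `E(0) = 1`.

Also a general complement to §6.1: an Appell sequence is `s_n = ψ(D) x^n` with
`ψ = Σ s_k (0) t^k/k!` (`IsAppellSequence.eq_diffOp_X_pow`).

## References
* [RotaKahanerOdlyzko1973] G.-C. Rota, D. Kahaner, A. Odlyzko, *On the foundations of
  combinatorial theory VIII. Finite operator calculus*, J. Math. Anal. Appl. 42 (1973) 684–760,
  §10 (*), (**), pp. 721–722.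
* [Robert2000PadicAnalysis] A. M. Robert, *A Course in p-adic Analysis*, GTM 198, Springer (2000),
  Ch. IV §6.1 (Appell sequences), pp. 205–206.
-/

noncomputable section

open Polynomial Finset

namespace Literature.Algebra.Polynomial

/-! ## The derivative rule `He_{n+1}' = (n+1) He_n` over `ℤ` -/

/-- **`D H_n = n H_{n−1}`** for Mathlib's (probabilists') Hermite polynomials:
`He_{n+1}' = (n + 1) He_n`, by induction from `He_{n+2} = x He_{n+1} − He_{n+1}'`.
[cite: RotaKahanerOdlyzko1973, §10 (*), p. 721] -/
theorem derivative_hermite_succ (n : ℕ) :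
    derivative (hermite (n + 1)) = ((n : ℤ[X]) + 1) * hermite n := by
  induction n using Nat.strong_induction_on with
  | _ n ih =>
    cases n with
    | zero =>
      rw [zero_add, hermite_one, derivative_X, hermite_zero, C_1, Nat.cast_zero, zero_add, mul_one]
    | succ m =>
      have h1 := ih m (Nat.lt_succ_self m)
      rw [hermite_succ (m + 1), derivative_sub, derivative_mul, derivative_X, one_mul, h1,
        derivative_mul, derivative_add, derivative_natCast, derivative_one, add_zero, zero_mul,
        zero_add]
      cases m with
      | zero =>
        rw [hermite_zero, C_1, derivative_one, mul_zero, sub_zero, hermite_one, Nat.cast_zero,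
          zero_add, one_mul, Nat.cast_one]
        ring
      | succ k =>
        rw [ih k (by omega), hermite_succ (k + 1), ih k (by omega)]
        push_cast
        ring

/-- `He_n' = n He_{n−1}` (all `n`). [cite: RotaKahanerOdlyzko1973, §10 (*), p. 721] -/
theorem derivative_hermite (n : ℕ) :
    derivative (hermite n) = (n : ℤ[X]) * hermite (n - 1) := by
  cases n with
  | zero => rw [hermite_zero, C_1, derivative_one, Nat.cast_zero, zero_mul]
  | succ n => rw [derivative_hermite_succ, Nat.add_sub_cancel, Nat.cast_succ]

variable (K : Type*) [Field K]

/-- The Hermite polynomials over a field `K` (Mathlib's `hermite n : ℤ[X]` mapped to `K[X]`).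
[cite: RotaKahanerOdlyzko1973, §10, p. 721] -/
theorem derivative_map_hermite_succ (n : ℕ) :
    derivative (Polynomial.map (Int.castRingHom K) (hermite (n + 1))) =
      ((n + 1 : ℕ) : K) • Polynomial.map (Int.castRingHom K) (hermite n) := by
  rw [derivative_map, derivative_hermite_succ, Polynomial.map_mul, Polynomial.map_add,
    Polynomial.map_natCast, Polynomial.map_one, smul_eq_C_mul, map_natCast, Nat.cast_succ]

/-- **The Hermite polynomials form an Appell sequence** ("the Appell set whose operator is the
Weierstrass operator"): `deg He_n = n` and `He_{n+1}' = (n+1) He_n`, over any field of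
characteristic `0`. [cite: RotaKahanerOdlyzko1973, §10 (*), p. 721]
[cite: Robert2000PadicAnalysis, Ch. IV §6.1 Definition (Appell sequence), p. 205] -/
theorem isAppellSequence_hermite [CharZero K] :
    IsAppellSequence fun n => Polynomial.map (Int.castRingHom K) (hermite n) := by
  refine ⟨fun n => ?_, fun n => derivative_map_hermite_succ K n⟩
  show (Polynomial.map (Int.castRingHom K) (hermite n)).degree = n
  rw [degree_map_eq_of_injective (RingHom.injective_int (Int.castRingHom K)), degree_hermite]

/-- **The addition formula** `H_n (x + y) = Σ_k C(n,k) y^{n−k} H_k (x)` — here in the Appell form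
`He_n (x + y) = Σ_{k=0}^{n} C(n,k) x^k He_{n−k} (y)`.
[cite: RotaKahanerOdlyzko1973, §10 (*), p. 721] -/
theorem hermite_eval_add [CharZero K] (n : ℕ) (x y : K) :
    (Polynomial.map (Int.castRingHom K) (hermite n)).eval (x + y) =
      ∑ k ∈ range (n + 1), (n.choose k : K) * x ^ k *
        (Polynomial.map (Int.castRingHom K) (hermite (n - k))).eval y :=
  (isAppellSequence_hermite K).eval_add n x y

/-! ## Appell sequences are `ψ(D) x^n` -/

variable {K}

/-- An Appell sequence is `s_n = ψ(D) x^n` for the composition operator `ψ(D)` with indicator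
`ψ = Σ_k s_k (0) t^k/k!` (Robert §6.1 Proposition with `p_n = x^n`; Rota–Kahaner–Odlyzko §5
Proposition 1 and Theorem 6 Corollary 1). [cite: Robert2000PadicAnalysis, Ch. IV §6.1 Proposition,
p. 206] [cite: RotaKahanerOdlyzko1973, §5 Theorem 6 Corollary 1, p. 700] -/
theorem IsAppellSequence.eq_diffOp_X_pow [CharZero K] {s : ℕ → K[X]} (hs : IsAppellSequence s)
    (n : ℕ) :
    s n = diffOp (PowerSeries.mk fun k => (s k).eval 0 / (k.factorial : K)) (X ^ n) := by
  rw [diffOp_apply_X_pow, hs.eq_sum n]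
  conv_rhs => rw [← sum_range_reflect]
  refine sum_congr rfl fun k hk => ?_
  have hkn : k ≤ n := Nat.lt_succ_iff.1 (mem_range.1 hk)
  have hk0 : ((n - k).factorial : K) ≠ 0 := Nat.cast_ne_zero.2 (Nat.factorial_ne_zero _)
  rw [PowerSeries.coeff_mk, Nat.add_sub_cancel, Nat.sub_sub_self hkn,
    Nat.descFactorial_eq_factorial_mul_choose, Nat.choose_symm hkn, Nat.cast_mul]
  congr 1
  field_simp

/-! ## `He_n = e^{−D²/2} x^n` -/

variable (K)

/-- The series `E (t) = e^{−t²/2} = Σ_m (−1/2)^m t^{2m}/m!` (the inverse `W_1^{−1}` of the indicator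
`e^{t²/2} = Σ a_n t^n/n!`, `a_{2m} = 1·3⋯(2m−1)`, of the Weierstrass operator), coefficientwise.
[cite: RotaKahanerOdlyzko1973, §10 (**), p. 722] -/
def expNegHalfSq : PowerSeries K :=
  PowerSeries.mk fun k => if Even k then (-(1 : K) / 2) ^ (k / 2) / ((k / 2).factorial : K) else 0

/-- `E (0) = 1`. [cite: RotaKahanerOdlyzko1973, §10 (**), p. 722] -/
theorem constantCoeff_expNegHalfSq : PowerSeries.constantCoeff (expNegHalfSq K) = 1 := by
  rw [← PowerSeries.coeff_zero_eq_constantCoeff_apply, expNegHalfSq, PowerSeries.coeff_mk,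
    if_pos (even_iff_two_dvd.2 (dvd_zero 2)), Nat.zero_div, pow_zero, Nat.factorial_zero, Nat.cast_one,
    div_one]

/-- **`E' = −t · E`** — the differential equation characterising `e^{−t²/2}` among series with
`E (0) = 1`. [cite: RotaKahanerOdlyzko1973, §10 (**), p. 722] -/
theorem derivative_expNegHalfSq [CharZero K] :
    PowerSeries.derivative K (expNegHalfSq K) = -(PowerSeries.X * expNegHalfSq K) := by
  ext n
  rw [PowerSeries.coeff_derivative, map_neg, expNegHalfSq, PowerSeries.coeff_mk]
  cases n with
  | zero =>
    rw [PowerSeries.coeff_zero_X_mul, neg_zero, zero_add, if_neg (by decide), zero_mul]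
  | succ m =>
    rw [PowerSeries.coeff_succ_X_mul, PowerSeries.coeff_mk]
    rcases Nat.even_or_odd m with hm | hm
    · -- `m = 2j`: both sides involve `t^{2j}`-coefficients
      obtain ⟨j, rfl⟩ := hm
      have he : Even (j + j + 1 + 1) := ⟨j + 1, by ring⟩
      have hj : (j + j + 1 + 1) / 2 = j + 1 := by omega
      have hj' : (j + j) / 2 = j := by omega
      rw [if_pos he, if_pos ⟨j, rfl⟩, hj, hj', pow_succ, Nat.factorial_succ, Nat.cast_mul,
        Nat.cast_succ]
      have hf : ((j.factorial : K)) ≠ 0 := Nat.cast_ne_zero.2 (Nat.factorial_ne_zero j)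
      have h2 : ((j : K) + 1) ≠ 0 := by exact_mod_cast Nat.succ_ne_zero j
      field_simp
      push_cast
      ring
    · obtain ⟨j, rfl⟩ := hm
      have ho : ¬ Even (2 * j + 1 + 1 + 1) := by
        rw [Nat.not_even_iff_odd]
        exact ⟨j + 1, by ring⟩
      have ho' : ¬ Even (2 * j + 1) := by
        rw [Nat.not_even_iff_odd]
        exact ⟨j, rfl⟩
      rw [if_neg ho, if_neg ho', zero_mul, neg_zero]

/-- The constant terms of the Hermite polynomials: `He_k (0)/k! = E_k`, i.e. `He_{2m} (0) =
(−1)^m (2m−1)!!` (Mathlib `coeff_hermite_explicit`) and `(2m)! = 2^m m! (2m−1)!!`, `He_{odd} (0) = 0`.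
[cite: RotaKahanerOdlyzko1973, §10 (**)–(***), p. 722] -/
theorem hermite_eval_zero_div_factorial [CharZero K] (k : ℕ) :
    (Polynomial.map (Int.castRingHom K) (hermite k)).eval 0 / (k.factorial : K) =
      PowerSeries.coeff k (expNegHalfSq K) := by
  rw [expNegHalfSq, PowerSeries.coeff_mk, ← coeff_zero_eq_eval_zero, coeff_map, eq_intCast]
  rcases Nat.even_or_odd k with ⟨m, rfl⟩ | ⟨m, rfl⟩
  · have hm : (m + m) / 2 = m := by omega
    rw [if_pos ⟨m, rfl⟩, hm, ← two_mul, ← add_zero (2 * m), coeff_hermite_explicit m 0, add_zero,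
      Nat.choose_zero_right, Nat.cast_one, mul_one]
    -- `(2m)! = 2^m m! (2m−1)!!`
    have hfac : ((2 * m).factorial : K) = 2 ^ m * (m.factorial : K) * ((2 * m - 1).doubleFactorial : K) := by
      cases m with
      | zero => simp
      | succ j =>
        have h1 := Nat.factorial_eq_mul_doubleFactorial (2 * j + 1)
        have h2 := Nat.doubleFactorial_two_mul (j + 1)
        rw [show 2 * (j + 1) = 2 * j + 1 + 1 by ring, h1, show 2 * j + 1 + 1 = 2 * (j + 1) by ring, h2,
          show 2 * (j + 1) - 1 = 2 * j + 1 by omega]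
        push_cast
        ring
    rw [hfac]
    have hf : (m.factorial : K) ≠ 0 := Nat.cast_ne_zero.2 (Nat.factorial_ne_zero m)
    have hd : ((2 * m - 1).doubleFactorial : K) ≠ 0 := Nat.cast_ne_zero.2 (Nat.doubleFactorial_pos _).ne'
    push_cast
    field_simp
    rw [← mul_pow]
    norm_num
  · have ho : ¬ Even (2 * m + 1) := by
      rw [Nat.not_even_iff_odd]
      exact ⟨m, rfl⟩
    rw [if_neg ho, coeff_hermite_of_odd_add (by rw [add_zero]; exact ⟨m, rfl⟩), Int.cast_zero, zero_div]

/-- **`H_n = W_1^{−1} x^n`, i.e. `He_n = e^{−D²/2} x^n`** (Rota–Kahaner–Odlyzko §10 (*), the defining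
property of the Hermite Appell set), for Mathlib's `hermite` over a field of characteristic `0`.
[cite: RotaKahanerOdlyzko1973, §10 (*), p. 721] -/
theorem hermite_eq_diffOp_X_pow [CharZero K] (n : ℕ) :
    Polynomial.map (Int.castRingHom K) (hermite n) = diffOp (expNegHalfSq K) (X ^ n) := by
  have h := (isAppellSequence_hermite K).eq_diffOp_X_pow n
  have hE : (PowerSeries.mk fun k =>
      (Polynomial.map (Int.castRingHom K) (hermite k)).eval 0 / (k.factorial : K)) = expNegHalfSq K := by
    ext k
    rw [PowerSeries.coeff_mk, hermite_eval_zero_div_factorial]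
  rw [hE] at h
  exact h

end Literature.Algebra.Polynomial
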